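import Mathlib
import Summits.Ventures.PercRepro2.OneTypedEdge
import Summits.Ventures.PercRepro2.TypedSplit
import Summits.Ventures.PercRepro2.TypedUntouched
import Summits.Ventures.PercRepro2.TypedSwapRoots
import Summits.Ventures.PercRepro2.TypedRootPathThree
import Summits.Ventures.PercRepro2.TypedPinnedMark

/-!
# A root–mark edge pinned open kills every typed base (blind cell PercRepro2, night-3 g14,
2026-08-27; `proofs/NIGHT3-CERT.md` §23.7)

For an edge `e = {a₁, b}`, `{a₁, o}` or `{a₁, a₃}` in `F` with `τ e = 3` (open in every copy) the
typed base vanishes: `typedCount_eq_zero_of_root_b_open` / `_root_o_open` (the contracted minor has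
`b`, resp. `o`, in `C(a₁)` in every configuration of its support — `TypedPinnedMark`) and
`typedCount_eq_zero_of_root_a3_open` (`a₃ ∈ U` in every copy: `PD` fails everywhere, pointwise).
Mirrors at `a₂`.  READING (row 2′T23): at a root–mark edge the contracted base `N₃ = N_{τ[e := 3]}`
is `0`, so there «`N₂ ≥ N₃`» is «`N₂ ≥ 0`» — the conjecture of record 2′T23 has content only at the
edges not joining a root to a mark.  Nothing here asserts anything about the original lane.
-/

namespace Summit.Ventures.PercRepro2

open UnionCluster

namespace CovForm

namespace PinnedMark

open OneTyped Untouched TypedRed RootPath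

section Main

open Classical

variable {V : Type*} {E : Type*} [Fintype E] [DecidableEq E] {R : Type*} [Field R]
  [LinearOrder R] [IsStrictOrderedRing R]
variable (ends : E → Sym2 V) (o a₁ a₂ a₃ b : V)

/-- **The root edge `{a₁, b}` open in every copy: every typed base vanishes.** -/
theorem typedCount_eq_zero_of_root_b_open {e : E} (he : ends e = s(a₁, b)) (F : Finset E)
    (heF : e ∈ F) (z : Config E) (τ : E → ℕ) (hτ : ∀ e' ∈ F.erase e, τ e' = 1 ∨ τ e' = 2)
    (hτe : τ e = 3) :
    typedCount F z τ (K3 ends o a₁ a₂ a₃ b : Config E → Config E → Config E → R) = 0 := by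
  rw [typedCount_type_three F e heF z τ hτe]
  refine typedCount_eq_zero_of_pinned_b ends o a₁ a₂ a₃ b (F.erase e) _ τ hτ fun x hx => ?_
  have hxe : x e = true := by
    rw [hx e (Finset.notMem_erase e F), Function.update_self]
  exact conn_of_openAdj ⟨e, hxe, he⟩

/-- **The root edge `{a₁, o}` open in every copy: every typed base vanishes.** -/
theorem typedCount_eq_zero_of_root_o_open {e : E} (he : ends e = s(a₁, o)) (F : Finset E)
    (heF : e ∈ F) (z : Config E) (τ : E → ℕ) (hτ : ∀ e' ∈ F.erase e, τ e' = 1 ∨ τ e' = 2)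
    (hτe : τ e = 3) :
    typedCount F z τ (K3 ends o a₁ a₂ a₃ b : Config E → Config E → Config E → R) = 0 := by
  rw [typedCount_type_three F e heF z τ hτe]
  refine typedCount_eq_zero_of_pinned_o ends o a₁ a₂ a₃ b (F.erase e) _ τ hτ fun x hx => ?_
  have hxe : x e = true := by
    rw [hx e (Finset.notMem_erase e F), Function.update_self]
  exact conn_of_openAdj ⟨e, hxe, he⟩

omit [LinearOrder R] [IsStrictOrderedRing R] in
/-- **The root edge `{a₁, a₃}` open in every copy: every typed base vanishes** (pointwise: `PD`
fails in every copy). -/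
theorem typedCount_eq_zero_of_root_a3_open {e : E} (he : ends e = s(a₁, a₃)) (F : Finset E)
    (heF : e ∈ F) (z : Config E) (τ : E → ℕ) (hτe : τ e = 3) :
    typedCount F z τ (K3 ends o a₁ a₂ a₃ b : Config E → Config E → Config E → R) = 0 := by
  rw [← typedCount_zero_kernel F z τ]
  refine typedCount_congr_on_support F z τ fun x y w _ hτ' => ?_
  have h3 := hτ' e heF
  rw [hτe] at h3
  have hx : x e = true := by
    cases hxe : x e <;> cases hye : y e <;> cases hwe : w e <;> simp_all [openCount]
  have hy : y e = true := by
    cases hxe : x e <;> cases hye : y e <;> cases hwe : w e <;> simp_all [openCount]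
  have pd : ∀ u : Config E, u e = true → pdB (st ends o a₁ a₂ a₃ b u) = 0 := fun u hu => by
    apply pdB_eq_zero_of_L3_or_H3
    unfold st St.L3
    exact Or.inl (decide_eq_true (conn_of_openAdj ⟨e, hu, he⟩))
  rw [K3_eq_KB, KB_eq_zero_of_pdB _ _ _ (pd x hx) (pd y hy)]
  simp

/-- The mirror: `{a₂, b}` open in every copy. -/
theorem typedCount_eq_zero_of_root_b_open' {e : E} (he : ends e = s(a₂, b)) (F : Finset E)
    (heF : e ∈ F) (z : Config E) (τ : E → ℕ) (hτ : ∀ e' ∈ F.erase e, τ e' = 1 ∨ τ e' = 2)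
    (hτe : τ e = 3) :
    typedCount F z τ (K3 ends o a₁ a₂ a₃ b : Config E → Config E → Config E → R) = 0 := by
  rw [← SwapRoots.typedCount_swap_roots ends o a₁ a₂ a₃ b F z τ]
  exact typedCount_eq_zero_of_root_b_open ends o a₂ a₁ a₃ b he F heF z τ hτ hτe

/-- The mirror: `{a₂, o}` open in every copy. -/
theorem typedCount_eq_zero_of_root_o_open' {e : E} (he : ends e = s(a₂, o)) (F : Finset E)
    (heF : e ∈ F) (z : Config E) (τ : E → ℕ) (hτ : ∀ e' ∈ F.erase e, τ e' = 1 ∨ τ e' = 2)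
    (hτe : τ e = 3) :
    typedCount F z τ (K3 ends o a₁ a₂ a₃ b : Config E → Config E → Config E → R) = 0 := by
  rw [← SwapRoots.typedCount_swap_roots ends o a₁ a₂ a₃ b F z τ]
  exact typedCount_eq_zero_of_root_o_open ends o a₂ a₁ a₃ b he F heF z τ hτ hτe

omit [LinearOrder R] [IsStrictOrderedRing R] in
/-- The mirror: `{a₂, a₃}` open in every copy. -/
theorem typedCount_eq_zero_of_root_a3_open' {e : E} (he : ends e = s(a₂, a₃)) (F : Finset E)
    (heF : e ∈ F) (z : Config E) (τ : E → ℕ) (hτe : τ e = 3) :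
    typedCount F z τ (K3 ends o a₁ a₂ a₃ b : Config E → Config E → Config E → R) = 0 := by
  rw [← SwapRoots.typedCount_swap_roots ends o a₁ a₂ a₃ b F z τ]
  exact typedCount_eq_zero_of_root_a3_open ends o a₂ a₁ a₃ b he F heF z τ hτe

end Main

end PinnedMark

end CovForm

end Summit.Ventures.PercRepro2
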